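import Literature.Computability.Complexity.WindowLemmas
import Literature.Computability.Complexity.HashBricks
import Literature.Computability.Complexity.CountingProofs
import HarnessLib

/-!
# The witness language of Toda's amplified count (second half of Toda's theorem: the machine)

Topic `Computability/Complexity` (counting classes). Arora–Barak 2009, proof of Thm. 17.14 from
Lemma 17.22 (p. 423); Toda 1991, §4. Given `L ∈ BP·⊕P` — coins `y ∈ {0,1}^m`, `m = p(n)`, and the
parity language `{z | #W(z) odd}` of a witness language `W ∈ P` with witness length `w = q(|z|)`,
`z = ⟨x, y⟩`, `|z| = 2n + 2 + m` — the derandomisation sums, over all `y`, the *amplified* counts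
`A⁺_ℓ(#W(x,y))`, `A⁻_ℓ(#W(x,y))` (`ModulusAmplification.lean`: `A⁺ − A⁻ ≡ [# odd] (mod 2^ℓ)`,
`ℓ = m + 1`), two `#P` functions of `x`. This file builds their **common witness language**
`todaLang W p q ∈ P` (`todaLang_mem_P`) and proves what it says about a witness string
(`mem_todaLang_iff`); the count `#todaLang(⟨x, [b]⟩) = Σ_y A^{b}_ℓ(#W(x, y))` is
`TodaWitnessCount.lean`, the assembly `TodaPartTwo.lean`.

## The witness layout (all lengths are polynomials in `n = |x|`)

A witness `u` of `⟨x, [b]⟩` (`b = 1`: positive half, `b = 0`: negative half) consists of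

  `y ∈ {0,1}^m` · mode bit · `s₁ ∈ {0,1}^ℓ` · `ℓ` blocks of length `w` · `s₂ ∈ {0,1}^{2ℓ−2}` · `2ℓ−2` blocks of length `w`

(offsets `0`, `m`, `m+1`, `2m+2`, `oS2 = 2m+2+ℓw`, `oB2 = oS2 + 2m`; total `LwP`). It is accepted iff
* mode `1`: `b = 1` and everything after the mode bit is `0` — one witness per `y`, the constant
  term `1` of `A⁺_ℓ = 1 + …`; or
* mode `0`: the parity of `|s₁|₁` is `b` (odd for `A⁺`, even for `A⁻`: the index `i` of
  `ModAmp.Apos`/`Aneg`); block `i` of the first group is a `W`-witness of `⟨x, y⟩` if `s₁[i] = 1`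
  and `0^w` otherwise (so `s₁` with `i` ones contributes `C(ℓ, i)`-fold the factor `#W^i`);
  `|s₂|₁ ≤ ℓ − 1` and every `1` of `s₂` sits at a position `< ℓ − 1 + |s₂|₁` (the strings with `j`
  ones are then `C(ℓ−1+j, j)` many: the coefficient of `T_ℓ`); block `e` of the second group is a
  `W`-witness if `s₂[e] = 1` and `0^w` otherwise (factor `#W^j`).

The tests are assembled from the tree's `FP` algebra as in `PostBPPHashCriterion.lean`'s companion files (frame
accessor `g`, windows `UnaryOffsets.windowFn`, unary pads `padFn`, `Kannan.bitFn`/`sufFn`,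
`HashBricks.popCountFn` with the unary-vs-binary test `Kannan.setOf_length_le_bitsToNat_mem_P`
for the two conditions involving `|s₂|₁`, the bounded quantifier `ballLang` over block indices).

## References

* S. Arora, B. Barak, *Computational Complexity: A Modern Approach*, CUP 2009, Lemma 17.22 and
  the proof of Thm. 17.14 (p. 423); Def. 17.2 (`#P` via witness languages).
* S. Toda, *PP is as hard as the polynomial-time hierarchy*, SIAM J. Comput. 20 (1991), §4.
-/

namespace Literature.Computability.Complexity

open _root_.Computability Polynomial PRelSigma OracleCompose TTClosure UnaryOffsets PPSharpP

namespace TodaCount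

variable (W : Language Bool) (p q : Polynomial ℕ)

/-! ### Size parameters -/

/-- The `⊕`-witness length `w = q(2n + 2 + m)` as a polynomial of `n`. [folklore] -/
noncomputable def wP : Polynomial ℕ := q.comp (2 * X + 2 + p)
/-- Offset `2m + 2` of the first block group. [folklore] -/
noncomputable def oB1 : Polynomial ℕ := 2 * p + 2
/-- Offset `2m + 2 + (m+1)·w` of `s₂`. [folklore] -/
noncomputable def oS2 : Polynomial ℕ := 2 * p + 2 + (p + 1) * wP p q
/-- Offset `oS2 + 2m` of the second block group. [folklore] -/
noncomputable def oB2 : Polynomial ℕ := oS2 p q + 2 * p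
/-- The witness length `oB2 + 2m·w`. [folklore] -/
noncomputable def LwP : Polynomial ℕ := oB2 p q + 2 * p * wP p q

/-- `w(n) = q(2n + 2 + m)`. [folklore] -/
@[simp] theorem eval_wP (n : ℕ) : (wP p q).eval n = q.eval (2 * n + 2 + p.eval n) := by simp [wP]
/-- Value of `oB1`. [folklore] -/
@[simp] theorem eval_oB1 (n : ℕ) : (oB1 p).eval n = 2 * p.eval n + 2 := by simp [oB1]
/-- Value of `oS2`. [folklore] -/
@[simp] theorem eval_oS2 (n : ℕ) : (oS2 p q).eval n = 2 * p.eval n + 2 + (p.eval n + 1) * (wP p q).eval n := by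
  simp [oS2, wP]
/-- Value of `oB2`. [folklore] -/
@[simp] theorem eval_oB2 (n : ℕ) : (oB2 p q).eval n = (oS2 p q).eval n + 2 * p.eval n := by
  simp only [oB2, eval_add, eval_mul, eval_ofNat]
/-- Value of `LwP`. [folklore] -/
@[simp] theorem eval_LwP (n : ℕ) : (LwP p q).eval n = (oB2 p q).eval n + 2 * p.eval n * (wP p q).eval n := by
  simp only [LwP, eval_add, eval_mul, eval_ofNat]

/-! ### Accessors (frame `z = ⟨⟨x, t⟩, u⟩`, frame accessor `g`) -/

section Accessors

variable (g : List Bool → List Bool)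

/-- The input `x`. [folklore] -/
def xA : List Bool → List Bool := fstP ∘ fstP ∘ g
/-- The tag `t`. [folklore] -/
def tA : List Bool → List Bool := sndP ∘ fstP ∘ g
/-- The witness `u`. [folklore] -/
def uA : List Bool → List Bool := sndP ∘ g
/-- `1^{r(|x|)}`. [folklore] -/
noncomputable def onesP (r : Polynomial ℕ) : List Bool → List Bool := padFn r ∘ pairFn (xA g) fun _ => []
/-- The window of `u` of length `r(|x|)` at the unary offset computed by `o`. [folklore] -/
noncomputable def win (o : List Bool → List Bool) (r : Polynomial ℕ) : List Bool → List Bool :=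
  windowFn r ∘ pairFn (pairFn (uA g) o) (xA g)
/-- The coins `y` (window at `0` of length `m`). [folklore] -/
noncomputable def yF : List Bool → List Bool := win g (fun _ => []) p
/-- `u ⇂ m` (its head is the mode bit). [folklore] -/
noncomputable def modeF : List Bool → List Bool := Kannan.bitFn (onesP g p) (uA g)
/-- `u ⇂ (m+1)` (everything after the mode bit). [folklore] -/
noncomputable def restF : List Bool → List Bool := Kannan.sufFn (onesP g p) (uA g)
/-- `s₁` (window at `m+1` of length `ℓ = m+1`). [folklore] -/
noncomputable def s1F : List Bool → List Bool := win g (List.cons true ∘ onesP g p) (p + 1)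
/-- `s₂` (window at `oS2` of length `2m`). [folklore] -/
noncomputable def s2F : List Bool → List Bool := win g (onesP g (oS2 p q)) (2 * p)
/-- `|s₂|₁` in binary. [folklore] -/
noncomputable def pc2F : List Bool → List Bool := HashBricks.popCountFn ∘ s2F p q g
/-- The block at offset `o₀(|x|) + ι·w` where `ι` is the loop index returned by `ix`. [folklore] -/
noncomputable def blkF (o₀ : Polynomial ℕ) (ix : List Bool → List Bool) : List Bool → List Bool :=
  win g (concatFn ∘ pairFn (onesP g o₀) (mulLenFn ∘ pairFn ix (onesP g (wP p q)))) (wP p q)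

variable {g}

/-- The accessors are in `FP`. [folklore] -/
theorem xA_mem_FP (hg : g ∈ FP) : xA g ∈ FP := comp_mem_FP fstP_mem_FP (comp_mem_FP fstP_mem_FP hg)
/-- See `xA_mem_FP`. [folklore] -/
theorem tA_mem_FP (hg : g ∈ FP) : tA g ∈ FP := comp_mem_FP sndP_mem_FP (comp_mem_FP fstP_mem_FP hg)
/-- See `xA_mem_FP`. [folklore] -/
theorem uA_mem_FP (hg : g ∈ FP) : uA g ∈ FP := comp_mem_FP sndP_mem_FP hg
/-- See `xA_mem_FP`. [folklore] -/
theorem onesP_mem_FP (hg : g ∈ FP) (r : Polynomial ℕ) : onesP g r ∈ FP :=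
  comp_mem_FP (padFn_mem_FP r) (pairFn_mem_FP (xA_mem_FP hg) (const_mem_FP []))
/-- See `xA_mem_FP`. [folklore] -/
theorem win_mem_FP (hg : g ∈ FP) {o : List Bool → List Bool} (ho : o ∈ FP) (r : Polynomial ℕ) : win g o r ∈ FP :=
  comp_mem_FP (windowFn_mem_FP r) (pairFn_mem_FP (pairFn_mem_FP (uA_mem_FP hg) ho) (xA_mem_FP hg))
/-- See `xA_mem_FP`. [folklore] -/
theorem yF_mem_FP (hg : g ∈ FP) : yF p g ∈ FP := win_mem_FP hg (const_mem_FP []) p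
/-- See `xA_mem_FP`. [folklore] -/
theorem modeF_mem_FP (hg : g ∈ FP) : modeF p g ∈ FP := Kannan.bitFn_mem_FP (onesP_mem_FP hg p) (uA_mem_FP hg)
/-- See `xA_mem_FP`. [folklore] -/
theorem restF_mem_FP (hg : g ∈ FP) : restF p g ∈ FP := Kannan.sufFn_mem_FP (onesP_mem_FP hg p) (uA_mem_FP hg)
/-- See `xA_mem_FP`. [folklore] -/
theorem s1F_mem_FP (hg : g ∈ FP) : s1F p g ∈ FP :=
  win_mem_FP hg (comp_mem_FP (cons_mem_FP true) (onesP_mem_FP hg p)) _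
/-- See `xA_mem_FP`. [folklore] -/
theorem s2F_mem_FP (hg : g ∈ FP) : s2F p q g ∈ FP := win_mem_FP hg (onesP_mem_FP hg _) _
/-- See `xA_mem_FP`. [folklore] -/
theorem pc2F_mem_FP (hg : g ∈ FP) : pc2F p q g ∈ FP := comp_mem_FP HashBricks.popCountFn_mem_FP (s2F_mem_FP p q hg)
/-- See `xA_mem_FP`. [folklore] -/
theorem blkF_mem_FP (hg : g ∈ FP) (o₀ : Polynomial ℕ) {ix : List Bool → List Bool} (hix : ix ∈ FP) :
    blkF p q g o₀ ix ∈ FP :=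
  win_mem_FP hg (comp_mem_FP concatFn_mem_FP (pairFn_mem_FP (onesP_mem_FP hg _)
    (comp_mem_FP mulLenFn_mem_FP (pairFn_mem_FP hix (onesP_mem_FP hg _))))) _

end Accessors

/-! ### The language -/

/-- The side: the tag starts with `1` (`A⁺`) or not (`A⁻`). [folklore] -/
def Side (g : List Bool → List Bool) : Language Bool := tA g ⁻¹' HeadIs true

/-- The witness test of a block: `⟨⟨x, y⟩, block⟩ ∈ W`. [folklore] -/
def WitTest (blk : List Bool → List Bool) : Language Bool := pairFn (pairFn (xA fstP) (yF p fstP)) blk ⁻¹' W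

/-- The per-block condition at depth one: if the flag (head of `fl`) is set, the block is a
`W`-witness of `⟨x, y⟩`, otherwise it is all-zero. [cite: AroraBarak2009, Thm. 17.14 (proof)] -/
def BlockCond (fl blk : List Bool → List Bool) : Language Bool :=
  ((fl ⁻¹' HeadIs true) ⊓ WitTest W p blk) ⊔ ((fl ⁻¹' HeadIs true)ᶜ ⊓ (blk ⁻¹' NoBit true))

/-- Loop body over the first block group (index `i < ℓ`): the block condition with flag `s₁[i]`.
[cite: AroraBarak2009, Thm. 17.14 (proof)] -/
def Body1 : Language Bool :=
  (pairFn (xA fstP) sndP ⁻¹' LenLt (p + 1))ᶜ ⊔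
    BlockCond W p (Kannan.bitFn sndP (s1F p fstP)) (blkF p q fstP (oB1 p) sndP)

/-- The spread condition of `s₂` at index `e`: `(e + 2) ∸ ℓ ≤ |s₂|₁`, i.e. `e < ℓ − 1 + |s₂|₁`
(so that strings with `j` ones realise the coefficient `C(ℓ−1+j, j)` of `ModAmp.T`, the explicit
Toda/Beigel–Tarui polynomial of `ModulusAmplification.lean`). [cite: AroraBarak2009, Thm. 17.14 (proof)] -/
def SpreadOk : Language Bool :=
  {c | (Kannan.bitFn (onesP fstP (p + 1)) (List.cons true ∘ List.cons true ∘ sndP) c).length ≤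
    bitsToNat (pc2F p q fstP c)}

/-- Loop body over the second block group (index `e < 2m`): the block condition with flag `s₂[e]`,
and the spread condition when the flag is set. [cite: AroraBarak2009, Thm. 17.14 (proof)] -/
def Body2 : Language Bool :=
  (pairFn (xA fstP) sndP ⁻¹' LenLt (2 * p))ᶜ ⊔
    (BlockCond W p (Kannan.bitFn sndP (s2F p q fstP)) (blkF p q fstP (oB2 p q) sndP) ⊓
      ((Kannan.bitFn sndP (s2F p q fstP) ⁻¹' HeadIs true)ᶜ ⊔ SpreadOk p q))

/-- `|s₂|₁ ≤ ℓ − 1`, i.e. not `ℓ ≤ |s₂|₁` (the range `j < ℓ` of `ModAmp.Apos`/`Aneg`). [cite: AroraBarak2009, Thm. 17.14 (proof)] -/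
def PcLe : Language Bool := {z | (onesP id (p + 1) z).length ≤ bitsToNat (pc2F p q id z)}ᶜ

/-- The parity of `|s₁|₁` is the side (odd `i` in `ModAmp.Apos`, even `i` in `ModAmp.Aneg`). [cite: AroraBarak2009, Thm. 17.14 (proof)] -/
def ParOk : Language Bool :=
  ((s1F p id ⁻¹' OddOnes) ⊓ Side id) ⊔ ((s1F p id ⁻¹' OddOnes)ᶜ ⊓ (Side id)ᶜ)

/-- Mode `1`: the constant term — positive side, everything after the mode bit zero.
[cite: AroraBarak2009, Thm. 17.14 (proof)] -/
def Lone : Language Bool := (modeF p id ⁻¹' HeadIs true) ⊓ Side id ⊓ (restF p id ⁻¹' NoBit true)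

/-- Mode `0`: the double sum of `ModAmp.Apos`/`Aneg`. [cite: AroraBarak2009, Thm. 17.14 (proof)] -/
def Lzero : Language Bool :=
  (modeF p id ⁻¹' HeadIs false) ⊓ ParOk p ⊓ ballLang (p + 1) (Body1 W p q) ⊓ PcLe p q ⊓ ballLang (2 * p) (Body2 W p q)

/-- **The witness language of the amplified counts.** [cite: AroraBarak2009, Thm. 17.14 (proof)] -/
def todaLang : Language Bool := Lone p ⊔ Lzero W p q

variable {W p q}

/-- `BlockCond ∈ P`. [folklore] -/
theorem BlockCond_mem_P (hW : W ∈ Classes.P) {fl blk : List Bool → List Bool} (hfl : fl ∈ FP) (hblk : blk ∈ FP) :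
    BlockCond W p fl blk ∈ Classes.P := by
  have hwt : WitTest W p blk ∈ Classes.P :=
    preimage_mem_P hW (pairFn_mem_FP (pairFn_mem_FP (xA_mem_FP fstP_mem_FP) (yF_mem_FP p fstP_mem_FP)) hblk)
  exact union_mem_P (inter_mem_P (preimage_mem_P (HeadIs_mem_P true) hfl) hwt)
    (inter_mem_P (compl_mem_P_iff.2 (preimage_mem_P (HeadIs_mem_P true) hfl)) (preimage_mem_P (NoBit_mem_P true) hblk))

/-- `Body1 ∈ P`. [folklore] -/
theorem Body1_mem_P (hW : W ∈ Classes.P) : Body1 W p q ∈ Classes.P :=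
  union_mem_P (compl_mem_P_iff.2 (preimage_mem_P (LenLt_mem_P _) (pairFn_mem_FP (xA_mem_FP fstP_mem_FP) sndP_mem_FP)))
    (BlockCond_mem_P hW (Kannan.bitFn_mem_FP sndP_mem_FP (s1F_mem_FP p fstP_mem_FP))
      (blkF_mem_FP p q fstP_mem_FP _ sndP_mem_FP))

/-- `SpreadOk ∈ P`. [folklore] -/
theorem SpreadOk_mem_P : SpreadOk p q ∈ Classes.P :=
  Kannan.setOf_length_le_bitsToNat_mem_P
    (Kannan.bitFn_mem_FP (onesP_mem_FP fstP_mem_FP _)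
      (comp_mem_FP (cons_mem_FP true) (comp_mem_FP (cons_mem_FP true) sndP_mem_FP)))
    (pc2F_mem_FP p q fstP_mem_FP)

/-- `Body2 ∈ P`. [folklore] -/
theorem Body2_mem_P (hW : W ∈ Classes.P) : Body2 W p q ∈ Classes.P := by
  have hfl : Kannan.bitFn sndP (s2F p q fstP) ∈ FP := Kannan.bitFn_mem_FP sndP_mem_FP (s2F_mem_FP p q fstP_mem_FP)
  exact union_mem_P
    (compl_mem_P_iff.2 (preimage_mem_P (LenLt_mem_P _) (pairFn_mem_FP (xA_mem_FP fstP_mem_FP) sndP_mem_FP)))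
    (inter_mem_P (BlockCond_mem_P hW hfl (blkF_mem_FP p q fstP_mem_FP _ sndP_mem_FP))
      (union_mem_P (compl_mem_P_iff.2 (preimage_mem_P (HeadIs_mem_P true) hfl)) SpreadOk_mem_P))

/-- `PcLe ∈ P`. [folklore] -/
theorem PcLe_mem_P : PcLe p q ∈ Classes.P :=
  compl_mem_P_iff.2 (Kannan.setOf_length_le_bitsToNat_mem_P (onesP_mem_FP id_mem_FP _) (pc2F_mem_FP p q id_mem_FP))

/-- `ParOk ∈ P`. [folklore] -/
theorem ParOk_mem_P : ParOk p ∈ Classes.P := by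
  have h1 : s1F p id ⁻¹' OddOnes ∈ Classes.P := preimage_mem_P OddOnes_mem_P (s1F_mem_FP p id_mem_FP)
  have h2 : Side id ∈ Classes.P := preimage_mem_P (HeadIs_mem_P true) (tA_mem_FP id_mem_FP)
  exact union_mem_P (inter_mem_P h1 h2) (inter_mem_P (compl_mem_P_iff.2 h1) (compl_mem_P_iff.2 h2))

/-- **`todaLang W p q ∈ P`** for `W ∈ P`. [cite: AroraBarak2009, Thm. 17.14 (proof)] -/
theorem todaLang_mem_P (hW : W ∈ Classes.P) : todaLang W p q ∈ Classes.P :=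
  union_mem_P
    (inter_mem_P (inter_mem_P (preimage_mem_P (HeadIs_mem_P true) (modeF_mem_FP p id_mem_FP))
      (preimage_mem_P (HeadIs_mem_P true) (tA_mem_FP id_mem_FP)))
      (preimage_mem_P (NoBit_mem_P true) (restF_mem_FP p id_mem_FP)))
    (inter_mem_P (inter_mem_P (inter_mem_P (inter_mem_P
      (preimage_mem_P (HeadIs_mem_P false) (modeF_mem_FP p id_mem_FP)) ParOk_mem_P)
      (ballLang_mem_P _ (Body1_mem_P hW))) PcLe_mem_P) (ballLang_mem_P _ (Body2_mem_P hW)))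


/-! ### Semantics -/

section Semantics


variable (x t u : List Bool)

local notation "𝔪" => Polynomial.eval (List.length x) p
local notation "𝔩" => Polynomial.eval (List.length x) p + 1
local notation "𝔴" => Polynomial.eval (List.length x) (wP p q)
local notation "𝔬₁" => 2 * Polynomial.eval (List.length x) p + 2
local notation "𝔬ₛ" => Polynomial.eval (List.length x) (oS2 p q)
local notation "𝔬₂" => Polynomial.eval (List.length x) (oB2 p q)

/-- The frame `⟨⟨x, t⟩, u⟩`. [folklore] -/
def frame : List Bool := boolPair (boolPair x t) u

/-- The decoded fields of a witness string: `y`, `s₁`, `s₂`, and the blocks of the two groups.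
[folklore] -/
def yOf : List Bool := window u 0 𝔪
/-- See `yOf`. [folklore] -/
def s1Of : List Bool := window u (𝔪 + 1) 𝔩
/-- See `yOf`. [folklore] -/
noncomputable def s2Of : List Bool := window u 𝔬ₛ (2 * 𝔪)
/-- See `yOf`. [folklore] -/
noncomputable def blk1Of (i : ℕ) : List Bool := window u (𝔬₁ + i * 𝔴) 𝔴
/-- See `yOf`. [folklore] -/
noncomputable def blk2Of (e : ℕ) : List Bool := window u (𝔬₂ + e * 𝔴) 𝔴

/-- The side read off the tag `t`: `t` starts with `1`. A predicate on the tag (explicit binder: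
this is a parametrised definition, not a named fact — nothing to discharge). [folklore] -/
def sideB (t : List Bool) : Prop := t.head? = some true

section Values

variable {x t u} {g : List Bool → List Bool} {c : List Bool} (hg : g c = frame x t u)
include hg

/-- Accessor values on a frame. [folklore] -/
theorem xA_eq : xA g c = x := by simp [xA, hg, frame]
/-- See `xA_eq`. [folklore] -/
theorem tA_eq : tA g c = t := by simp [tA, hg, frame]
/-- See `xA_eq`. [folklore] -/
theorem uA_eq : uA g c = u := by simp [uA, hg, frame]
/-- See `xA_eq`. [folklore] -/
theorem onesP_eq (r : Polynomial ℕ) : onesP g r c = List.replicate (r.eval x.length) true := by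
  simp [onesP, padFn_apply, xA_eq hg]
/-- See `xA_eq`. [folklore] -/
theorem win_eq (o : List Bool → List Bool) (r : Polynomial ℕ) : win g o r c = window u (o c).length (r.eval x.length) := by
  simp [win, windowFn_apply, xA_eq hg, uA_eq hg]
/-- See `xA_eq`. [folklore] -/
theorem yF_eq : yF p g c = yOf (p := p) x u := by rw [yF, win_eq hg]; rfl
/-- See `xA_eq`. [folklore] -/
theorem modeF_eq : modeF p g c = u.drop 𝔪 := by simp [modeF, onesP_eq hg, uA_eq hg]
/-- See `xA_eq`. [folklore] -/
theorem restF_eq : restF p g c = u.drop (𝔪 + 1) := by simp [restF, Kannan.sufFn_apply, onesP_eq hg, uA_eq hg]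
/-- See `xA_eq`. [folklore] -/
theorem s1F_eq : s1F p g c = s1Of (p := p) x u := by
  rw [s1F, win_eq hg]; simp [onesP_eq hg, s1Of]
/-- See `xA_eq`. [folklore] -/
theorem s2F_eq : s2F p q g c = s2Of (p := p) (q := q) x u := by
  rw [s2F, win_eq hg]; simp only [onesP_eq hg, List.length_replicate, eval_mul, eval_ofNat]; rfl
/-- See `xA_eq`. [folklore] -/
theorem pc2F_eq : pc2F p q g c = encodeNat ((s2Of (p := p) (q := q) x u).count true) := by
  simp [pc2F, s2F_eq hg]
/-- See `xA_eq`. [folklore] -/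
theorem blkF_eq (o₀ : Polynomial ℕ) (ix : List Bool → List Bool) :
    blkF p q g o₀ ix c = window u (o₀.eval x.length + (ix c).length * 𝔴) 𝔴 := by
  rw [blkF, win_eq hg]; simp [onesP_eq hg]
/-- See `xA_eq`. [folklore] -/
theorem mem_Side_iff : c ∈ Side g ↔ sideB t := by rw [Side, memL_preimage, tA_eq hg, mem_HeadIs, sideB]

end Values

/-- Reading a bit with `Kannan.bitFn`: the complement of "head `1`" is "`getD = 0`". [folklore] -/
theorem bitFn_not_mem_HeadIs_true_iff (f g : List Bool → List Bool) (w : List Bool) :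
    Kannan.bitFn f g w ∉ HeadIs true ↔ (g w).getD (f w).length false = false := by
  rw [bitFn_mem_HeadIs_true_iff]; cases (g w).getD (f w).length false <;> simp

/-- **Semantics of the block condition.** [folklore] -/
theorem mem_BlockCond_iff {fl blk : List Bool → List Bool} {c : List Bool} (hc : fstP c = frame x t u)
    {s : List Bool} {i : ℕ} (hfl : fl c = s.drop i) :
    c ∈ BlockCond W p fl blk ↔
      (s.getD i false = true → boolPair (boolPair x (yOf (p := p) x u)) (blk c) ∈ W) ∧
        (s.getD i false = false → true ∉ blk c) := by
  have hbit : fl c ∈ HeadIs true ↔ s.getD i false = true := by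
    rw [mem_HeadIs, hfl, Kannan.head?_drop_eq_some_true_iff]
  rw [BlockCond, memL_sup, Language.mem_inf, Language.mem_inf, memL_compl, memL_preimage, hbit, WitTest, memL_preimage, memL_preimage,
    pairFn_apply, pairFn_apply, xA_eq hc, yF_eq hc, mem_NoBit]
  cases s.getD i false <;> simp

/-! #### The specification of the two block groups and the main statement -/

variable (W p q)

/-- Block group one: block `i < ℓ` is a `W`-witness of `⟨x, y⟩` if `s₁[i] = 1`, all-zero otherwise.
A predicate on `(W, p, q, x, u)` (explicit binders: a parametrised specification used by
`mem_ballLang_Body1_iff` / `mem_todaLang_iff`, not a named fact; `ℓ = p(|x|) + 1` is spelled out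
because the local notation `𝔩` captures the section variables). [cite: AroraBarak2009, Thm. 17.14 (proof)] -/
def Blocks1Spec (W : Language Bool) (p q : Polynomial ℕ) (x u : List Bool) : Prop :=
  ∀ i < Polynomial.eval (List.length x) p + 1, ((s1Of (p := p) x u).getD i false = true →
      boolPair (boolPair x (yOf (p := p) x u)) (blk1Of (p := p) (q := q) x u i) ∈ W) ∧
    ((s1Of (p := p) x u).getD i false = false → true ∉ blk1Of (p := p) (q := q) x u i)

/-- Block group two: block `e < 2m` is a `W`-witness if `s₂[e] = 1` (and then `e < ℓ − 1 + |s₂|₁`),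
all-zero otherwise. A predicate on `(W, p, q, x, u)` (explicit binders, `m = p(|x|)` and `ℓ = m + 1`
spelled out; see `Blocks1Spec`). [cite: AroraBarak2009, Thm. 17.14 (proof)] -/
def Blocks2Spec (W : Language Bool) (p q : Polynomial ℕ) (x u : List Bool) : Prop :=
  ∀ e < 2 * Polynomial.eval (List.length x) p, (((s2Of (p := p) (q := q) x u).getD e false = true →
      boolPair (boolPair x (yOf (p := p) x u)) (blk2Of (p := p) (q := q) x u e) ∈ W) ∧
    ((s2Of (p := p) (q := q) x u).getD e false = false → true ∉ blk2Of (p := p) (q := q) x u e)) ∧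
    ((s2Of (p := p) (q := q) x u).getD e false = true →
      e + 2 - (Polynomial.eval (List.length x) p + 1) ≤ (s2Of (p := p) (q := q) x u).count true)

variable {W p q}

/-- The frame dominates `|x|` in length. [folklore] -/
theorem length_le_frame : x.length ≤ (frame x t u).length := by
  simp only [frame, length_boolPair]; omega

/-- **Semantics of block group one** (`ballLang (p+1) Body1`). [cite: AroraBarak2009, Thm. 17.14 (proof)] -/
theorem mem_ballLang_Body1_iff :
    frame x t u ∈ ballLang (p + 1) (Body1 W p q) ↔ Blocks1Spec W p q x u := by
  rw [mem_ballLang, Blocks1Spec]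
  have hc : ∀ i : ℕ, fstP (boolPair (frame x t u) (List.replicate i true)) = frame x t u := fun i => fstP_boolPair _ _
  have hbody : ∀ i : ℕ, boolPair (frame x t u) (List.replicate i true) ∈ Body1 W p q ↔
      (i < 𝔩 → ((s1Of (p := p) x u).getD i false = true →
          boolPair (boolPair x (yOf (p := p) x u)) (blk1Of (p := p) (q := q) x u i) ∈ W) ∧
        ((s1Of (p := p) x u).getD i false = false → true ∉ blk1Of (p := p) (q := q) x u i)) := fun i => by
    rw [Body1, memL_sup, memL_compl, memL_preimage, pairFn_apply, xA_eq (hc i), sndP_boolPair, boolPair_mem_LenLt,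
      List.length_replicate, eval_add, eval_one,
      mem_BlockCond_iff x t u (hc i) (s := s1Of (p := p) x u) (i := i)
        (by rw [Kannan.bitFn_apply, s1F_eq (hc i), sndP_boolPair, List.length_replicate]),
      blkF_eq (hc i), sndP_boolPair, List.length_replicate, eval_oB1]
    change ¬ i < 𝔩 ∨ _ ↔ _
    by_cases hi : i < 𝔩
    · simp only [hi, not_true_eq_false, false_or, forall_true_left, blk1Of]
    · simp only [hi, not_false_eq_true, true_or, IsEmpty.forall_iff]
  simp only [hbody, eval_add, eval_one]
  have hle : 𝔩 ≤ p.eval (frame x t u).length + 1 := by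
    have := TM2Iter.eval_mono p (length_le_frame x t u); omega
  exact ⟨fun H i hi => H i (lt_of_lt_of_le hi hle) hi, fun H i _ hi => H i hi⟩

/-- **Semantics of block group two** (`ballLang (2p) Body2`). [cite: AroraBarak2009, Thm. 17.14 (proof)] -/
theorem mem_ballLang_Body2_iff :
    frame x t u ∈ ballLang (2 * p) (Body2 W p q) ↔ Blocks2Spec W p q x u := by
  rw [mem_ballLang, Blocks2Spec]
  have hc : ∀ e : ℕ, fstP (boolPair (frame x t u) (List.replicate e true)) = frame x t u := fun e => fstP_boolPair _ _
  have hbody : ∀ e : ℕ, boolPair (frame x t u) (List.replicate e true) ∈ Body2 W p q ↔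
      (e < 2 * 𝔪 → ((((s2Of (p := p) (q := q) x u).getD e false = true →
          boolPair (boolPair x (yOf (p := p) x u)) (blk2Of (p := p) (q := q) x u e) ∈ W) ∧
        ((s2Of (p := p) (q := q) x u).getD e false = false → true ∉ blk2Of (p := p) (q := q) x u e)) ∧
        ((s2Of (p := p) (q := q) x u).getD e false = true → e + 2 - 𝔩 ≤ (s2Of (p := p) (q := q) x u).count true))) := fun e => by
    have hfl : Kannan.bitFn sndP (s2F p q fstP) (boolPair (frame x t u) (List.replicate e true)) =
        (s2Of (p := p) (q := q) x u).drop e := by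
      rw [Kannan.bitFn_apply, s2F_eq (hc e), sndP_boolPair, List.length_replicate]
    have hspread : boolPair (frame x t u) (List.replicate e true) ∈ SpreadOk p q ↔
        e + 2 - 𝔩 ≤ (s2Of (p := p) (q := q) x u).count true := by
      rw [SpreadOk]
      change (Kannan.bitFn (onesP fstP (p + 1)) (List.cons true ∘ List.cons true ∘ sndP)
        (boolPair (frame x t u) (List.replicate e true))).length ≤ bitsToNat (pc2F p q fstP _) ↔ _
      rw [Kannan.bitFn_apply, onesP_eq (hc e), pc2F_eq (hc e), bitsToNat_encodeNat]
      simp only [Function.comp_apply, sndP_boolPair, List.length_drop, List.length_cons, List.length_replicate, eval_add,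
        eval_one]
    rw [Body2, memL_sup, memL_compl, memL_preimage, pairFn_apply, xA_eq (hc e), sndP_boolPair, boolPair_mem_LenLt,
      List.length_replicate, eval_mul, eval_ofNat, Language.mem_inf, memL_sup, memL_compl, memL_preimage,
      bitFn_not_mem_HeadIs_true_iff, s2F_eq (hc e), sndP_boolPair, List.length_replicate, hspread,
      mem_BlockCond_iff x t u (hc e) (s := s2Of (p := p) (q := q) x u) (i := e) hfl,
      blkF_eq (hc e), sndP_boolPair, List.length_replicate]
    change ¬ e < 2 * 𝔪 ∨ _ ↔ _
    by_cases he : e < 2 * 𝔪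
    · simp only [he, not_true_eq_false, false_or, forall_true_left, blk2Of]
      cases (s2Of (p := p) (q := q) x u).getD e false <;> simp
    · simp only [he, not_false_eq_true, true_or, IsEmpty.forall_iff]
  simp only [hbody, eval_mul, eval_ofNat]
  have hle : 2 * 𝔪 ≤ 2 * p.eval (frame x t u).length := by
    have := TM2Iter.eval_mono p (length_le_frame x t u); omega
  exact ⟨fun H e he => H e (lt_of_lt_of_le he hle) he, fun H e _ he => H e he⟩

/-- **What `todaLang` says about a witness.** On the frame `⟨⟨x, t⟩, u⟩`: either the mode bit
`u[m]` is `1`, the side is positive and everything after the mode bit is `0`; or the mode bit is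
`0`, the parity of `|s₁|₁` is the side, block group one is as specified, `|s₂|₁ ≤ ℓ − 1`, and
block group two is as specified. [cite: AroraBarak2009, Thm. 17.14 (proof)] -/
theorem mem_todaLang_iff :
    frame x t u ∈ todaLang W p q ↔
      ((u.drop 𝔪).head? = some true ∧ sideB t ∧ true ∉ u.drop (𝔪 + 1)) ∨
      ((u.drop 𝔪).head? = some false ∧ (Odd ((s1Of (p := p) x u).count true) ↔ sideB t) ∧
        Blocks1Spec W p q x u ∧ ¬ (𝔩 ≤ (s2Of (p := p) (q := q) x u).count true) ∧ Blocks2Spec W p q x u) := by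
  have hg : id (frame x t u) = frame x t u := rfl
  rw [todaLang, memL_sup]
  refine or_congr ?_ ?_
  · rw [Lone, Language.mem_inf, Language.mem_inf, memL_preimage, modeF_eq hg, mem_HeadIs, mem_Side_iff hg, memL_preimage,
      restF_eq hg, mem_NoBit, and_assoc]
  · rw [Lzero, Language.mem_inf, Language.mem_inf, Language.mem_inf, Language.mem_inf, memL_preimage, modeF_eq hg, mem_HeadIs,
      mem_ballLang_Body1_iff, mem_ballLang_Body2_iff]
    have hpar : frame x t u ∈ ParOk p ↔ (Odd ((s1Of (p := p) x u).count true) ↔ sideB t) := by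
      rw [ParOk, memL_sup, Language.mem_inf, Language.mem_inf, memL_compl, memL_compl, memL_preimage, s1F_eq hg, mem_OddOnes,
        mem_Side_iff hg]
      tauto
    have hpc : frame x t u ∈ PcLe p q ↔ ¬ (𝔩 ≤ (s2Of (p := p) (q := q) x u).count true) := by
      rw [PcLe, memL_compl]
      change ¬ ((onesP id (p + 1) (frame x t u)).length ≤ bitsToNat (pc2F p q id (frame x t u))) ↔ _
      rw [onesP_eq hg, pc2F_eq hg, bitsToNat_encodeNat, List.length_replicate, eval_add, eval_one]
    rw [hpar, hpc]
    tauto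

end Semantics

end TodaCount

end Literature.Computability.Complexity
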